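import Summits.RiemannHypothesis.RiemannHypothesis.Theses.SignCone
import HarnessLib

/-!
# RiemannHypothesis / SignCone — assembly item `Assembly`

Route `RiemannHypothesis/SignCone`, assembly item — rev 9 (2026-08-17T12:50Z), item
`stmt-RiemannHypothesis-18116`:
`Assembly := SignConeInequality → ConeMagnification → SignConeDuality → Summit.RiemannHypothesis`,
the type of the route's deciding theorem `closes` in its bridge form: the prime-free sign-cone
inequality `X`, magnification on the slack cones (`ConeMagnification`, closed: the 2001 theorem
W-MAG, kernel-checked) and conic duality at each cutoff (`SignConeDuality`, closed) give RH.

The implication is pure logic. `ConeMagnification` reduces RH to producing, at every cutoff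
`a > 0`, a nonnegative integer-supported weight whose fake Weil form has unit slack on the Weil
tests supported in `[-a, a]`; `SignConeDuality` produces such a weight at cutoff `a` from the
unit-slack sign-cone inequality at cutoff `a`, which is `X` at `a`. We give the one-line proof
directly (it is the same term as `closes`), so the theorem does not depend on the gate-written
deciding theorem. Since the route was closed (superseded, 2026-08-17T13:36Z) the regenerated route
file no longer carries `closes`; `signCone_closes` below re-homes it by name under `Theorems`
(tree-health repair: the former `example : Assembly := closes` stopped elaborating at 46:2).

History: up to rev 8 the item (then `stmt-RiemannHypothesis-15465`) was the rev-2 four-binder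
statement `SignConeOscillatory → ConeMagnification → SignConeDuality → SignConeFarField →
Summit.RiemannHypothesis` (the sign-cone inequality split classically into its far-field-nonnegative
and oscillatory cases). That statement is equally true and is kept, with its original proof, as
`signConeAssembly_fourBinder_proof` (explicit type; all four decls are still route decls).
-/

-- the summit-side namespace `Summit.RiemannHypothesis.RiemannHypothesis.…` (D-0017: Sub = Summit) repeats a component
set_option linter.dupNamespace false

namespace Summit.RiemannHypothesis.RiemannHypothesis.Theorems

open Summit.RiemannHypothesis.RiemannHypothesis.Theses.SignCone

/-- **Item `stmt-RiemannHypothesis-18116` (`SignCone.Assembly`, rev 9 bridge form).** The three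
binders of the route's deciding theorem imply the Riemann hypothesis: magnification on the slack
cones (`ConeMagnification`) asks for a unit-slack fake weight at every cutoff `a > 0`; conic duality
(`SignConeDuality`) supplies it at cutoff `a` from the unit-slack sign-cone inequality at cutoff `a`,
i.e. from `SignConeInequality` specialised to `a`. Same term as `closes`. [folklore] -/
theorem signConeAssembly_proof :
    Summit.RiemannHypothesis.RiemannHypothesis.Theses.SignCone.Assembly :=
  fun hX hC h₃ => hC (fun a ha => h₃ a ha (hX a ha))

/-- **The route's deciding theorem `closes`, re-homed by name** (bridge form, rev 7/9): the unit-slack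
sign-cone inequality, magnification on the slack cones and conic duality at each cutoff give the
Riemann hypothesis. The gate stripped the glue `closes` from `Theses/SignCone.lean` when the route was
closed (superseded by `WeilPos`, 2026-08-17T13:36Z); this is the same term (`signConeAssembly_proof`
at the unfolded type of `Assembly`), kept citable under `Theorems` as `mayerPairing_closes` is for the
retired `MayerPairing` route. [folklore] -/
theorem signCone_closes :
    SignConeInequality → ConeMagnification → SignConeDuality → Summit.RiemannHypothesis :=
  signConeAssembly_proof

/-- **The rev-2 four-binder assembly** (former item `stmt-RiemannHypothesis-15465`, proved at
19f3f593e3d2 under the name `signConeAssembly_proof`; kept verbatim under this name after the rev-9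
restatement). The four items imply RH: `ConeMagnification` asks for a unit-slack fake weight at every
cutoff; `SignConeDuality` supplies it from the unit-slack sign-cone inequality at that cutoff; and
that inequality is the disjunction of its far-field-nonnegative case (`SignConeFarField`) and its
oscillatory case (`SignConeOscillatory`), decided classically on `∀ t, log 2 ≤ |t| → 0 ≤ Re F t`. [folklore] -/
theorem signConeAssembly_fourBinder_proof :
    SignConeOscillatory → ConeMagnification → SignConeDuality → SignConeFarField →
      Summit.RiemannHypothesis := by
  intro h₁ h₂ h₃ h₄
  refine h₂ (fun a ha => h₃ a ha ?_)
  intro k g hg F hn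
  by_cases hff : ∀ t : ℝ, Real.log 2 ≤ |t| → 0 ≤ (F t).re
  · exact h₄ a ha k g hg hn hff
  · push Not at hff
    exact h₁ a ha k g hg hn hff

/-- The four-binder form through the bridge form: the oscillatory and far-field cases reassemble the
sign-cone inequality `X`, then `signConeAssembly_proof` applies. [folklore] -/
theorem signConeAssembly_fourBinder_of_bridge
    (h : Summit.RiemannHypothesis.RiemannHypothesis.Theses.SignCone.Assembly) :
    SignConeOscillatory → ConeMagnification → SignConeDuality → SignConeFarField →
      Summit.RiemannHypothesis := by
  intro h₁ h₂ h₃ h₄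
  refine h ?_ h₂ h₃
  intro a ha k g hg F hn
  by_cases hff : ∀ t : ℝ, Real.log 2 ≤ |t| → 0 ≤ (F t).re
  · exact h₄ a ha k g hg hn hff
  · push Not at hff
    exact h₁ a ha k g hg hn hff

end Summit.RiemannHypothesis.RiemannHypothesis.Theorems
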